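import Summits.ABC.IUTFork.Cor312UnitShells
import Summits.ABC.IUTFork.Cor312NaiveThm311
import HarnessLib

/-!
# [IUTchIII] Cor. 3.12 — the UNIT-INDETERMINACY test model, II: PAIRWISE DISTINCT vertical lines, typed Theorem 3.11 holds

Record-only file (D-0012; MODEL DATA, no `Prop` fact, nothing asserted about print) of the abc-iut cell (wave-4 prover
abc-iut-w4-d101, gen 4). TAKES NO SIDE on [IUTchIII] Cor. 3.12. Sequel to `Cor312UnitShells` (part I: the `p`-adic unit shells
`unitShells p`, whose indeterminacy group `⟨(Ind1) ∪ (Ind2)⟩` is the INFINITE group of `p`-adic unit multiplications, acting on the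
packet lines by units and fixing every ball).

PURPOSE. In the countermodel of record (abc-iut-w5-d247's `NaiveWitness.naiveFull`, p415437, under `PinnedWitness.pinnedSetting`,
p419720) the data (a)(b)(c) of ALL vertical lines `(n, ∘)` COINCIDE, so the concluding assertion of [IUTchIII] Thm. 3.11 (i),
`Situation.MultiradialCompat : ∀ n n', ^{n,∘}ℜ^LGP = ^{n',∘}ℜ^LGP` (c312-1, `Thm311Multirad`; kurims `paper:url-4b091feeb646` p. 154 l. 40 –
p. 155 l. 9), holds by `rfl` (abc-iut-w5-d161's clause census 2026-08-26T05:19:50Z, item C3: «identical vertical lines»). Here: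

* `uData p` — the data (a)(b)(c) of line `0`: integral structures `B_0`, admissible regions the balls, log-volume `μ(B_k) = −k·log p`,
  splitting monoid abc-iut-w5-d247's `Ψ_v = {(±q^{j²})_j}` acting by coordinatewise multiplication, number-field copy the global packet;
* `uLine p n := (uData p).map (uFam (u₀^n))` — **the data of the vertical line `n` is the TRANSPORT of the line-`0` data by the
  (Ind2)-family of the unit `u₀^n`**, `u₀ = 1 + p` (`MRData.map`, c312-1): its splitting monoid is `{(±u₀^{n(j+1)}·q^{j²})_j}`, so the lines
  are PAIRWISE DISTINCT (`uLine_injective`) — and `MultiradialCompat` holds through a GENUINE non-identity indeterminacy move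
  (`u_multiradialCompat`: `^{n,∘}ℜ^LGP = ^{n',∘}ℜ^LGP` because both lines are one (Ind2)-move away from line `0`), not by `rfl`;
* `uColumn p n` — the Frobenius-like data of column `n` at `(n, m)` read through the Kummer isomorphism = the line-`n` data transported by
  abc-iut-w5-d247's SIGN twist `(−1)^m` (`NaiveWitness.twist`; the printed «only … roots of unity» are related through the log-links,
  Thm. 3.11 (ii) p. 156 l. 1–6): KummerB holds because the unit transport and the sign twist COMMUTE and `Ψ_v` is torsion-saturated;
* `uFull p` — the full situation (link data: w5-d247's `naiveLink` over the one-object groupoid of `ℤˣ`), and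
  **`uFull_statement` — the typed [IUTchIII] Theorem 3.11 (i) ∧ (ii) ∧ (iii) HOLDS**;
* §4: the indeterminacy group does NOT act by signs (`uFam_moves_beyond_signs`) and is INFINITE (`indClosure_infinite`).

HONEST SCOPE. Interface-level model over c312-7's one-place index `toyIndex` (`l⋇ = 2`): one place, so the sub-packet of (i)(b) is
the whole packet (w5-d247's `subPacket_eq_top` — the remaining «content-free» clause of w5-d161's census); not a model of initial
Θ-data. The pin-respecting countermodel over this situation is part III (`Cor312UnitCountermodel`). [claim: Mochizuki2012, status: disputed]
[cite: ScholzeStix2018, §2.2 pp. 9–10]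
-/

noncomputable section

open Set

namespace Summit.ABC.IUTFork.Cor312Vol.UnitWitness

open Thm311 Cor312 Cor312.Checks Cor312.IdentifiedNonVacuity NaiveWitness Literature.IUT.LogThetaLattice

variable (p : ℕ) [hp : Fact p.Prime]

/-! ## 1. The data (a)(b)(c) of line `0` and of line `n` -/

omit hp in
/-- **The data (a)(b)(c) of the vertical line `0`** over the unit shells ([IUTchIII] Thm. 3.11 (i)): integral structures the unit
balls `B_0`, admissible regions the balls, log-volume `μ(B_k) = −k·log p`; splitting monoid `Ψ_v = {(±q^{j²})_j}` (abc-iut-w5-d247's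
`NaiveWitness.Psi`) acting by coordinatewise multiplication; number-field copy the global packet. [claim: Mochizuki2012, status: disputed] -/
def uData : MRData (unitShells p) where
  shellPk := fun j vQ => uBall p j vQ 0
  shellSub := fun j v => uBall p j (toyIndex.over v) 0
  Adm := fun j vQ A => ∃ k, A = uBall p j vQ k
  logvol := fun j vQ A => uVol p j vQ A
  Ψ := fun v _ => Psi p v
  act := fun v _ y => LinearMap.pi fun j => (line j.1 (toyIndex.over v) (y j)) • LinearMap.proj j
  Mmod := fun _ => Set.univ

/-- The (Ind2)-family of the column unit `u₀^n`. [claim: Mochizuki2012, status: disputed] -/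
def lineFam (n : ℤ) : (unitShells p).PacketAut := uFam p (u₀ p ^ n) (u₀_zpow_isPUnit p n).1

/-- `lineFam n` is an (Ind2)-family. [folklore] -/
theorem lineFam_mem_Ind2Family (n : ℤ) : lineFam p n ∈ (unitShells p).Ind2Family :=
  uFam_mem_Ind2Family p (u₀_zpow_isPUnit p n)

/-- `lineFam n` acts by units. [folklore] -/
theorem lineFam_actsByUnits (n : ℤ) : ActsByUnits p (lineFam p n) := uFam_actsByUnits p (u₀_zpow_isPUnit p n)

/-- **The data (a)(b)(c) of the vertical line `n`**: the transport (c312-1's `MRData.map`) of the line-`0` data by the (Ind2)-family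
of the unit `u₀^n`. [claim: Mochizuki2012, status: disputed] -/
def uLine (n : ℤ) : MRData (unitShells p) := (uData p).map (lineFam p n)

/-- The admissible regions of line `n` are the balls (units fix balls). [folklore] -/
theorem uLine_adm_iff (n : ℤ) (j : toyIndex.Label) (vQ : toyIndex.VQ) (A : Set ((unitShells p).Packet j vQ)) :
    (uLine p n).Adm j vQ A ↔ ∃ k, A = uBall p j vQ k := by
  show (∃ k, ((lineFam p n) j vQ).symm '' A = uBall p j vQ k) ↔ _
  exact exists_congr fun k => symm_image_eq_uBall_iff_of_actsByUnits (lineFam_actsByUnits p n) j vQ A k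

/-- The log-volume of line `n` on a ball is the ball's log-volume … [folklore] -/
theorem uLine_logvol_eq (n : ℤ) (j : toyIndex.Label) (vQ : toyIndex.VQ) (k : ℤ) :
    (uLine p n).logvol j vQ (uBall p j vQ k) = uVol p j vQ (uBall p j vQ k) :=
  congrArg (uVol p j vQ) (symm_image_uBall_of_actsByUnits (lineFam_actsByUnits p n) j vQ k)

/-- … namely `μ(B_k) = −k·log p`. [folklore] -/
theorem uLine_logvol_uBall (n : ℤ) (j : toyIndex.Label) (vQ : toyIndex.VQ) (k : ℤ) :
    (uLine p n).logvol j vQ (uBall p j vQ k) = -(k : ℝ) * Real.log p :=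
  (uLine_logvol_eq p n j vQ k).trans (uVol_uBall p j vQ k)

/-- The integral structure of line `n` is `B_0`. [folklore] -/
theorem uLine_shellPk (n : ℤ) (j : toyIndex.Label) (vQ : toyIndex.VQ) : (uLine p n).shellPk j vQ = uBall p j vQ 0 :=
  image_uBall_of_actsByUnits (lineFam_actsByUnits p n) j vQ 0

/-- The splitting monoid of line `n` is the `u₀^n`-transport of `Ψ_v`. [folklore] -/
theorem uLine_Psi (n : ℤ) (v : toyIndex.V) (hv : v ∈ toyIndex.Vbad) :
    (uLine p n).Ψ v hv = (unitShells p).starAut (lineFam p n) v '' Psi p v := rfl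

/-- The number-field copy of line `n` is the whole global packet. [folklore] -/
theorem uLine_Mmod (n : ℤ) (j : toyIndex.LabelStar) : (uLine p n).Mmod j = Set.univ :=
  Set.image_univ_of_surjective ((unitShells p).globalAut (lineFam p n) j.1).surjective

/-- The tuple `(u₀^{n(j+1)}·q^{j²})_j` — the transport of the theta values — lies in the splitting monoid of line `n`. [folklore] -/
theorem transport_thetaValues_mem (n : ℤ) (v : toyIndex.V) (hv : v ∈ toyIndex.Vbad) :
    (unitShells p).starAut (lineFam p n) v (thetaValues p v) ∈ (uLine p n).Ψ v hv :=
  ⟨thetaValues p v, thetaValues_mem_Psi p v, rfl⟩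

/-- The label-`1` component of a member of the line-`n` splitting monoid has coordinate `±u₀^{2n}·q`. [folklore] -/
theorem line_one_of_mem_uLine_Psi (n : ℤ) (v : toyIndex.V) (hv : v ∈ toyIndex.Vbad)
    {f : (unitShells p).StarPacket v} (hf : f ∈ (uLine p n).Ψ v hv) :
    line 1 (toyIndex.over v) (f ⟨1, by decide⟩) = (u₀ p ^ n) ^ 2 * p ∨
      line 1 (toyIndex.over v) (f ⟨1, by decide⟩) = -((u₀ p ^ n) ^ 2 * p) := by
  obtain ⟨g, hg, rfl⟩ := hf
  have h1 : line 1 (toyIndex.over v) ((unitShells p).starAut (lineFam p n) v g ⟨1, by decide⟩) =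
      (u₀ p ^ n) ^ (((1 : toyIndex.Label) : ℕ) + 1) * line 1 (toyIndex.over v) (g ⟨1, by decide⟩) :=
    line_uFam p (u₀ p ^ n) (u₀_zpow_isPUnit p n).1 1 (toyIndex.over v) (g ⟨1, by decide⟩)
  have h2 : (((1 : toyIndex.Label) : ℕ) + 1) = 2 := rfl
  have hq : ((p : ℚ) ^ (((1 : toyIndex.Label) : ℕ) ^ 2)) = p := by
    have : (((1 : toyIndex.Label) : ℕ) ^ 2) = 1 := rfl
    rw [this, pow_one]
  rw [h2] at h1
  rcases hg ⟨1, by decide⟩ with h | h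
  · left; rw [h1, h, hq]
  · right; rw [h1, h, hq, mul_neg]

/-- **The vertical lines are PAIRWISE DISTINCT**: `n ↦ uLine n` is injective (read off the label-`1` components of the splitting
monoids: `u₀^{2n}·q`). [folklore] -/
theorem uLine_injective : Function.Injective (uLine p) := by
  intro n n' h
  have hmem : (unitShells p).starAut (lineFam p n) () (thetaValues p ()) ∈ (uLine p n').Ψ () (Set.mem_univ _) := by
    rw [← h]; exact transport_thetaValues_mem p n () _
  have h1 := line_one_of_mem_uLine_Psi p n' () _ hmem
  have h0 : line 1 (toyIndex.over ()) ((unitShells p).starAut (lineFam p n) () (thetaValues p ()) ⟨1, by decide⟩) =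
      (u₀ p ^ n) ^ 2 * p := by
    rcases line_one_of_mem_uLine_Psi p n () _ (transport_thetaValues_mem p n () (Set.mem_univ _)) with h' | h'
    · exact h'
    · exfalso
      have h3 : line 1 (toyIndex.over ()) ((unitShells p).starAut (lineFam p n) () (thetaValues p ()) ⟨1, by decide⟩) =
          (u₀ p ^ n) ^ (((1 : toyIndex.Label) : ℕ) + 1) * line 1 (toyIndex.over ()) (thetaValues p () ⟨1, by decide⟩) :=
        line_uFam p (u₀ p ^ n) (u₀_zpow_isPUnit p n).1 1 (toyIndex.over ()) (thetaValues p () ⟨1, by decide⟩)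
      have h4 : line 1 (toyIndex.over ()) (thetaValues p () ⟨1, by decide⟩) = (p : ℚ) ^ (((1 : toyIndex.Label) : ℕ) ^ 2) :=
        LinearEquiv.apply_symm_apply _ _
      have h5 : (((1 : toyIndex.Label) : ℕ) + 1) = 2 := rfl
      have h6 : (((1 : toyIndex.Label) : ℕ) ^ 2) = 1 := rfl
      rw [h4, h5, h6, pow_one] at h3
      rw [h3] at h'
      have hppos : (0 : ℚ) < p := by exact_mod_cast hp.out.pos
      have hpos : (0 : ℚ) < (u₀ p ^ n) ^ 2 * p :=
        mul_pos (pow_pos (zpow_pos (zero_lt_one.trans (one_lt_u₀ p)) n) 2) hppos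
      linarith
  rw [h0] at h1
  have hp0 : (p : ℚ) ≠ 0 := Nat.cast_ne_zero.mpr hp.out.ne_zero
  have hu : 0 < u₀ p := zero_lt_one.trans (one_lt_u₀ p)
  rcases h1 with h1 | h1
  · have h2 : (u₀ p ^ n) ^ 2 = (u₀ p ^ n') ^ 2 := mul_right_cancel₀ hp0 h1
    have h3 : u₀ p ^ n = u₀ p ^ n' := by
      have ha : 0 < u₀ p ^ n := zpow_pos hu n
      have hb : 0 < u₀ p ^ n' := zpow_pos hu n'
      nlinarith [h2, ha, hb, sq_nonneg (u₀ p ^ n - u₀ p ^ n'), sq_nonneg (u₀ p ^ n + u₀ p ^ n')]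
    exact u₀_zpow_injective p h3
  · exfalso
    have hppos : (0 : ℚ) < p := by exact_mod_cast hp.out.pos
    have ha : (0 : ℚ) < (u₀ p ^ n) ^ 2 * p := mul_pos (pow_pos (zpow_pos hu n) 2) hppos
    have hb : (0 : ℚ) < (u₀ p ^ n') ^ 2 * p := mul_pos (pow_pos (zpow_pos hu n') 2) hppos
    linarith

/-! ## 2. The situation: degrees, columns, link data -/

omit hp in
/-- **(c)'s global realified Frobenioids**: objects the fractional ideals `p^k𝒪`, degree `−k·log p`, region the ball `B_k` (as in
abc-iut-w5-d247's `naiveDegrees`). [claim: Mochizuki2012, status: disputed] -/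
def uDegrees (j : toyIndex.LabelStar) : GlobalDegrees (unitShells p) j where
  ObjMOD := ℤ
  Objmod := ℤ
  natIso := Equiv.refl ℤ
  deg := fun k => -(k : ℝ) * Real.log p
  region := fun k vQ => uBall p j.1 vQ k

/-- **The UNIT SITUATION**: unit shells, the line-`n` data the `u₀^n`-transport of the line-`0` data (an `abbrev`: `(uSituation p).L`
reduces to `unitShells p`). [claim: Mochizuki2012, status: disputed] -/
abbrev uSituation : Situation toyIndex where
  L := unitShells p
  D := uLine p
  G := fun _ j => uDegrees p j

/-- **The column `n`** ([IUTchIII] Thm. 3.11 (ii)): the Frobenius-like data at `(n,m)` read on the coric packets through the Kummer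
isomorphism = the line-`n` data transported by the sign twist `(−1)^m` (abc-iut-w5-d247's `twist`); unit-group images at iterate `m'`
the balls `B_{m'+1}`; Frobenioid objects the tagged copies of `ℤ` with the forgetful Kummer bijections; Θ-pilot the object of index
`1`. [claim: Mochizuki2012, status: disputed] -/
def uColumn (n : ℤ) : Column (unitShells p) where
  frobAdm := fun m j vQ A => ∃ k, (twist m : (unitShells p).PacketAut) j vQ '' A = uBall p j vQ k
  frobLogvol := fun m j vQ A => uVol p j vQ ((twist m : (unitShells p).PacketAut) j vQ '' A)
  frobΨ := fun m v hv => (unitShells p).starAut (twist m) v '' (uLine p n).Ψ v hv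
  frobMmod := fun m j => (unitShells p).globalAut (twist m) j.1 '' (uLine p n).Mmod j
  unitImage := fun _ m' j vQ => uBall p j vQ ((m' : ℤ) + 1)
  ballImage := fun _ j vQ => uBall p j vQ 0
  ObjLGP := ℤ
  frobObjLGP := FrobObj
  kumLGP := kum
  ObjLgp := ℤ
  frobObjLgp := FrobObj
  kumLgp := kum
  thetaPilot := fun m => ⟨(1, m), rfl⟩

/-- **The full situation of [IUTchIII] Thm. 3.11 in the unit model** (link data: abc-iut-w5-d247's `naiveLink`). An `abbrev`.
[claim: Mochizuki2012, status: disputed] -/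
abbrev uFull : FullSituation toyIndex where
  toSituation := uSituation p
  col := uColumn p
  link := naiveLink

/-! ## 3. The typed Theorem 3.11 (i) ∧ (ii) ∧ (iii) holds -/

/-- Line `n` is ONE indeterminacy move away from line `0`. [folklore] -/
theorem indMoves_uData_uLine (n : ℤ) : MRData.IndMoves (uData p) (uLine p n) :=
  ⟨lineFam p n, Or.inr (lineFam_mem_Ind2Family p n), rfl⟩

/-- **Thm. 3.11 (i), concluding assertion, CONTENTFULLY**: `^{n,∘}ℜ^LGP = ^{n',∘}ℜ^LGP` for all `n, n'` — the distinct lines `n`, `n'` are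
related by indeterminacy moves (through line `0`). [folklore] -/
theorem u_multiradialCompat : (uFull p).MultiradialCompat := fun n n' =>
  (MRData.RLGP_eq_iff _ _).2
    (Relation.EqvGen.trans _ _ _ (Relation.EqvGen.symm _ _ (Relation.EqvGen.rel _ _ (indMoves_uData_uLine p n)))
      (Relation.EqvGen.rel _ _ (indMoves_uData_uLine p n')))

/-- … while the lines' data are pairwise distinct. [folklore] -/
theorem uFull_lines_distinct (n n' : ℤ) (h : (uFull p).D n = (uFull p).D n') : n = n' :=
  uLine_injective p h

/-- (i): splitting monoids in the sub-packets (one place: the sub-packet is everything), the degree of `p^k𝒪` IS the global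
log-volume of its region, multiradial compatibility through the unit moves. [folklore] -/
theorem u_partI : (uFull p).PartI := by
  refine ⟨fun n v hv x _ j => ?_, fun n j k => ⟨fun vQ => (uLine_adm_iff p n _ vQ _).2 ⟨k, rfl⟩, Set.toFinite _, ?_⟩,
    u_multiradialCompat p⟩
  · show x j ∈ signShells.SubPacket j.1 v
    rw [subPacket_eq_top]; trivial
  · rw [finsum_unique]
    exact (uLine_logvol_uBall p n j.1 _ k).symm

omit hp in
/-- The sign twist is an element of ⟨(Ind1) ∪ (Ind2)⟩ of the UNIT shells (`−1` is a unit) and acts by units. [folklore] -/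
theorem twist_actsByUnits (m : ℤ) : ActsByUnits p (twist m : (unitShells p).PacketAut) :=
  actsByUnits_of_actsBySigns (twist_actsBySigns m)

/-- The sign twist fixes every ball. [folklore] -/
theorem image_uBall_twist (m : ℤ) (j : toyIndex.Label) (vQ : toyIndex.VQ) (k : ℤ) :
    (twist m : (unitShells p).PacketAut) j vQ '' uBall p j vQ k = uBall p j vQ k :=
  image_uBall_of_actsByUnits (twist_actsByUnits p m) j vQ k

omit hp in
/-- `negFamily` is an (Ind2)-family of the unit shells. [folklore] -/
theorem negFamily_mem_Ind2FamilyU : (negFamily : (unitShells p).PacketAut) ∈ (unitShells p).Ind2Family := fun _ _ =>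
  ⟨fun _ _ => LinearEquiv.neg ℚ, fun _ _ => signs_subset_padicUnits p (Set.mem_insert_of_mem _ rfl), rfl⟩

omit hp in
/-- The twist lies in ⟨(Ind1) ∪ (Ind2)⟩ of the unit shells. [folklore] -/
theorem twist_mem_closureU (m : ℤ) :
    (twist m : (unitShells p).PacketAut) ∈ Subgroup.closure ((unitShells p).Ind1Family ∪ (unitShells p).Ind2Family) := by
  unfold twist
  split_ifs
  · exact Subgroup.one_mem _
  · exact Subgroup.subset_closure (Or.inr (negFamily_mem_Ind2FamilyU p))

/-- **(ii) (b) KummerB, CONTENTFULLY**: the sign-twisted transport of the line-`n` splitting monoid IS the line-`n` splitting monoid —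
the twist commutes with the unit transport (`ActsByUnits.image_starAut_comm`) and `Ψ_v` is torsion-saturated (w5-d247's
`image_Psi_of_actsBySigns`). [folklore] -/
theorem uColumn_kummerB (n : ℤ) : (uColumn p n).KummerB (uLine p n) := by
  intro m v hv
  show (unitShells p).starAut (twist m) v '' ((unitShells p).starAut (lineFam p n) v '' Psi p v) =
    (unitShells p).starAut (lineFam p n) v '' Psi p v
  rw [(twist_actsByUnits p m).image_starAut_comm (lineFam_actsByUnits p n)]
  exact congrArg _ (image_Psi_of_actsBySigns p (twist_actsBySigns m) v)

/-- (ii), column by column: KummerA ⟸ the twist fixes balls; KummerB above; KummerC ⟸ the twist is onto; (Ind3) = `B_{m'+1} ⊆ B_0`.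
[folklore] -/
theorem u_partII : (uFull p).toLatticeSituation.PartII := by
  intro n
  refine (Column.partII_iff _ _).2 ⟨?_, uColumn_kummerB p n, fun m j => ?_, ?_⟩
  · intro m j vQ A hA
    obtain ⟨k, rfl⟩ := (uLine_adm_iff p n j vQ A).1 hA
    refine ⟨⟨k, image_uBall_twist p m j vQ k⟩, ?_⟩
    exact (congrArg (uVol p j vQ) (image_uBall_twist p m j vQ k)).trans (uLine_logvol_eq p n j vQ k).symm
  · show (unitShells p).globalAut (twist m) j.1 '' (uLine p n).Mmod j = (uLine p n).Mmod j
    exact (congrArg _ (uLine_Mmod p n j)).trans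
      ((Set.image_univ_of_surjective ((unitShells p).globalAut (twist m) j.1).surjective).trans (uLine_Mmod p n j).symm)
  · refine ⟨fun m m' j vQ _ => ?_, fun m j vQ h => absurd trivial h⟩
    exact (uBall_mono p j vQ (show (0 : ℤ) ≤ (m' : ℤ) + 1 by omega)).trans (uLine_shellPk p n j vQ).symm.subset

/-- (iii): squares of full poly-isomorphisms commute; the Kummer isomorphism `(−1)^m` is equivariant for the `ℤˣ`-automorphisms; full
permutation poly-isomorphisms are stabilized (as for w5-d247's `naiveFull`; the link data are the same). [folklore] -/
theorem u_partIII : (uFull p).PartIII := by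
  refine ⟨naiveLink.partIIIa_holds, naiveLink.partIIIb_holds, ?_, ?_,
    (uFull p).evalCompatUpToInd_of_multiradialCompat (u_multiradialCompat p)⟩
  · refine naiveLink.partIIIc_of_full (fun _ => rfl) fun n m => ?_
    rintro _ ⟨a, rfl⟩
    show unitIso a ≪≫ unitIso ((-1) ^ m.natAbs) = unitIso ((-1) ^ m.natAbs) ≪≫ unitIso a
    rw [unitIso_trans, unitIso_trans, mul_comm]
  · intro n m; exact Thm311.PolyIsoCalc.stabilized_full _ _

/-- **The typed [IUTchIII] Theorem 3.11 (i) ∧ (ii) ∧ (iii) HOLDS in the unit model.** [folklore] -/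
theorem uFull_statement : (uFull p).Statement := ⟨u_partI p, u_partII p, u_partIII p⟩

/-! ## 4. The non-degeneracy of the Thm. 3.11 data, recorded -/

/-- **The indeterminacy group does NOT act by signs**: the (Ind2)-family `uFam u₀` moves the point of coordinate `1` of the label-`0`
packet to the point of coordinate `1 + p`, which is neither it nor its negative. [folklore] -/
theorem uFam_moves_beyond_signs (vQ : toyIndex.VQ) :
    uFam p (u₀ p) (u₀_isPUnit p).1 0 vQ ((line 0 vQ).symm 1) ≠ (line 0 vQ).symm 1 ∧
      uFam p (u₀ p) (u₀_isPUnit p).1 0 vQ ((line 0 vQ).symm 1) ≠ -(line 0 vQ).symm 1 := by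
  have h1 := line_uFam p (u₀ p) (u₀_isPUnit p).1 0 vQ ((line 0 vQ).symm 1)
  rw [LinearEquiv.apply_symm_apply, mul_one] at h1
  have hu := one_lt_u₀ p
  constructor
  · intro h
    rw [h, LinearEquiv.apply_symm_apply] at h1
    have : (u₀ p) ^ (((0 : toyIndex.Label) : ℕ) + 1) = u₀ p := by simp
    rw [this] at h1
    linarith
  · intro h
    rw [h, map_neg, LinearEquiv.apply_symm_apply] at h1
    have : (u₀ p) ^ (((0 : toyIndex.Label) : ℕ) + 1) = u₀ p := by simp
    rw [this] at h1
    linarith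

/-- `n ↦ uFam (u₀^n)` is injective (read off the label-`0` packet line). [folklore] -/
theorem uFam_zpow_injective :
    Function.Injective fun n : ℤ => uFam p (u₀ p ^ n) (u₀_zpow_isPUnit p n).1 := by
  intro n n' h
  have h1 := congrArg (fun Φ : (unitShells p).PacketAut => line 0 () (Φ 0 () ((line 0 ()).symm 1))) h
  simp only [line_uFam, LinearEquiv.apply_symm_apply, mul_one] at h1
  have h0 : (((0 : toyIndex.Label) : ℕ) + 1) = 1 := rfl
  rw [h0, pow_one, pow_one] at h1
  exact u₀_zpow_injective p h1

/-- **The group generated by (Ind1), (Ind2) of the unit shells is INFINITE.** [folklore] -/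
theorem indClosure_infinite :
    (Subgroup.closure ((unitShells p).Ind1Family ∪ (unitShells p).Ind2Family) : Set (unitShells p).PacketAut).Infinite :=
  Set.infinite_of_injective_forall_mem (uFam_zpow_injective p) fun n => uFam_mem_closure p (u₀_zpow_isPUnit p n)


/-- The splitting monoid of every line is nonempty and contains no zero vector. [folklore] -/
theorem uLine_Psi_nonempty_zero_notMem (n : ℤ) (v : toyIndex.V) (hv : v ∈ toyIndex.Vbad) :
    ((uLine p n).Ψ v hv).Nonempty ∧ (0 : (unitShells p).StarPacket v) ∉ (uLine p n).Ψ v hv := by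
  refine ⟨⟨_, transport_thetaValues_mem p n v hv⟩, ?_⟩
  rintro ⟨g, hg, h0⟩
  have : g = 0 := by
    have := congrArg ((unitShells p).starAut (lineFam p n) v).symm h0
    rw [LinearEquiv.symm_apply_apply, map_zero] at this
    exact this
  exact zero_notMem_Psi p v (this ▸ hg)

/-- The column-`n` Kummer image of the Frobenius-like splitting monoid at ANY `(n, m)` is the line-`n` splitting monoid (KummerB), in
particular independent of `m` but DEPENDENT on `n`. [folklore] -/
theorem uColumn_frobΨ (n m : ℤ) (v : toyIndex.V) (hv : v ∈ toyIndex.Vbad) :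
    (uColumn p n).frobΨ m v hv = (uLine p n).Ψ v hv :=
  uColumn_kummerB p n m v hv

end Summit.ABC.IUTFork.Cor312Vol.UnitWitness

end
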